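import Literature.NumberTheory.EllipticCurves.HeckeGrossencharakterFunctionalEquation
import Literature.NumberTheory.EllipticCurves.BurungaleKobayashiNakamuraOta2026.RubinPadicLFunction
import Literature.NumberTheory.EllipticCurves.ComplexMultiplicationDeuringGrossencharacter
import HarnessLib

/-!
# The sign hypotheses of [BKNO] Thm. 1.5 / 1.8 EXIST: `IsCentralRootNumberWt ψ k (±1)` for the
# interpolated characters, from Hecke's functional equation (proof file; 0 definitions, 0 facts)

Topic `Literature/NumberTheory/EllipticCurves`; namespace
`Literature.NumberTheory.EllipticCurves.BurungaleKobayashiNakamuraOta2026`. Typing layer `pub/bsd-littype/`,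
seat bsd-littype-10 (gen 7). THEOREMS ONLY (kernel lane): the weight-`2k+2` spelling
`IsCentralRootNumberWt` (`RubinPadicLFunction.lean` §1: entire `Λ(s) = Γ(s)B^s L(ψ,s)` on `re s > k+3/2`,
`Λ(s) = W·Λ(2k+2−s)`; "the functional equation is NOT asserted") of the corollaries of the named fact
`Hecke_functionalEquation_infinityType` (`HeckeGrossencharakterFunctionalEquation.lean`: Hecke 1920 /
de Shalit II.1.1 (1)–(3) / Neukirch VII (8.5)–(8.6), for Größencharaktere of an imaginary quadratic
field of infinity type `(m, 0)`), at `m = 2k+1`: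

* `exists_isCentralRootNumberWt_of_conjEquivariant` — `ψ` conj-equivariant of type `(2k+1, 0)` ⟹
  `∃ w ∈ {1, −1}, IsCentralRootNumberWt ψ k w` ([BKNO] §4.1.2: for `ψ` satisfying (3.1) up to `|·|^{2k}`
  "its sign is the same as that of the functional equation", `ε ∈ {±1}`);
* `exists_isCentralRootNumberWt_pow` — **the K7r input `H_FE` in the Deuring currency**: for `φ` of type
  `(1,0)` with `φ ∘ c = φ̄` (clauses (i)–(ii) of `Deuring_exists_heckeCharacter_of_maximalCM`) and every
  `k`, `∃ w ∈ {±1}, IsCentralRootNumberWt (φ ^ (2k+1)) k w` — the hypothesis `hFE`/`hw` of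
  `Theorems/RamifiedSevenEllipticUnitsRubinPackageReduction` (`isCentralRootNumberWt_interpolated_one_of_xi`,
  `oddPowerContinuation_of_FE`) and of `RamifiedSevenEllipticUnitsCentralSignOfNonvanishing`, for such `φ`;
* `exists_isCentralRootNumberWt_pow_mul` — the same for the twists `φ^{2k+1}ρ`, `ρ` finite-order
  anticyclotomic ([BKNO]'s interpolated characters `φ^{2k+1}η_ac^{−k}χ` with `η∘c = η`, i.e.
  `φ^{2k+1}χ`: the shape of the `hsgn` binders of `RubinPadicLFunctionData.thm412`, up to the sign value);
* `hasEntireContinuationFrom_pow_odd` — **the K7r input `S_hecke` in the Deuring currency**: entire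
  continuation of `L(φ^{2k+1}, s)` from `re s > k + 3/2` (`X12.O11.RamifiedCMOddPowerContinuationAtZp`'s
  conclusion, for `φ` of type `(1,0)`; no equivariance needed);
* `exists_pinned_functionalEquations_of_maximalCM` — granted BOTH named facts (Deuring + Hecke): every
  maximal-order CM curve `E/ℚ` carries a pinned Hecke character (`L(φ,s) = L(E,s)` on `re s > 3/2`)
  of type `(1,0)`, conj-equivariant, ALL of whose odd powers have a weight-`(2k+2)` functional
  equation with sign `±1` and an entire continuation from `re s > k+3/2`.

* (appended) `IsHeckeConjEquivariant.exists_valuePairs_of_generators` and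
  `Deuring_exists_heckeCharacter_of_maximalCM_withGenerators.exists_with_valuePairs` — **the K7r inputs
  (P1)/(P5) in the Deuring currency**: clauses (ii) (`ψ ∘ c = ψ̄`) + (vi) (generator values) give, off a
  finite set of places, `ψ(ϖ_w) = σ(α)`, `ψ(ϖ_{c•w}) = σ(cα)`, `α ∉ 𝔭` — literally the hypothesis `hφ` of
  `Theorems/RamifiedSevenEllipticUnitsLemmaXiDeuringGlue`'s `RubinPadicLFunctionData.galConj_η_eq_of_values`
  (via `conj ∘ σ = σ ∘ c` on an imaginary quadratic field, `starRingEnd_embedding_eq_embedding_algEquiv`).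

HONEST SCOPE (for the K7r line owner): `H_FE`/`S_hecke` as REGISTERED quantify over every number field
`K` and every `φ` pinned to a curve BY ITS `L`-FUNCTION ALONE; print (and this file) deliver them for
`φ` of infinity type `(1,0)` [and conj-equivariant] over an imaginary quadratic `K` — the currency in
which every O11 frame obtains its `φ` (`Deuring_exists_heckeCharacter_of_maximalCM` (i)–(ii), (v)). The
bridge "pinned by `L`-function ⟹ type `(1,0)` ∧ equivariant" is NOT in print in the tree's idelic
language and is not supplied here. Nothing about BSD is asserted; [BKNO] (arXiv:2608.06879, preprint)
enters only through the name of the predicate.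

References: [deShalit1987] II.1.1 (1)–(3); [NeukirchANT1999] VII (8.5)–(8.6) (pp. 502–503);
[Iwasawa2019] Thm. 3.1; [HeckeMathZ1920]; [Jia2026ActaArith] §1, §2 (3)–(5);
[BurungaleKobayashiNakamuraOta2026] §4.1.2 (p. 25), Thm. 4.12 (p. 32), Thm. 1.5/1.8 (pp. 6–8);
[SilvermanATAEC1994] II Thm. 9.2, Thm. 10.5 (b).
-/

noncomputable section

open scoped ComplexConjugate
open NumberField IsDedekindDomain WeierstrassCurve
open Literature.NumberTheory.Automorphic Literature.NumberTheory.GaloisRepresentations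
  Literature.NumberTheory.DiophantineGeometry Literature.NumberTheory.EllipticCurves

namespace Literature.NumberTheory.EllipticCurves.BurungaleKobayashiNakamuraOta2026

variable {K : Type} [Field K] [NumberField K]

/-- **`IsCentralRootNumberWt ψ k (±1)` for a conj-equivariant character of infinity type `(2k+1, 0)`**
(Hecke's functional equation in weight `2k+2`, self-dual case): from
`Hecke_functionalEquation_infinityType.selfDual` at `m = 2k+1` — the half-plane `re s > m/2+1` is
`re s > k + 3/2` and `m + 1 − s = 2k + 2 − s`. [BKNO] §4.1.2: the sign `ε(ψ) ∈ {±1}` of the functional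
equation of a character satisfying (3.1) up to a power of the norm. [cite: deShalit1987, II.1.1 (1)–(3)]
[cite: BurungaleKobayashiNakamuraOta2026, §4.1.2 (arXiv:2608.06879 p. 25) (shape only)] -/
theorem exists_isCentralRootNumberWt_of_conjEquivariant (h : Hecke_functionalEquation_infinityType)
    (hK : IsImaginaryQuadratic K) {c : K ≃ₐ[ℚ] K} {ψ : HeckeCharacter K} {k : ℕ}
    (hψ : ψ.HasInfinityType (fun _ ↦ ((2 * k + 1 : ℕ) : ℤ)) (fun _ ↦ 0))
    (heq : IsHeckeConjEquivariant c ψ) :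
    ∃ w : ℂ, (w = 1 ∨ w = -1) ∧ IsCentralRootNumberWt ψ k w := by
  obtain ⟨B, W, Λ, hB, hW, hΛ, hagree, hFE⟩ := h.selfDual hK (m := 2 * k + 1) (by omega) hψ heq
  refine ⟨W, hW, B, hB, Λ, hΛ, fun s hs ↦ hagree s ?_, fun s ↦ ?_⟩
  · have e : (((2 * k + 1 : ℕ) : ℝ)) / 2 + 1 = (k : ℝ) + 3 / 2 := by push_cast; ring
    rw [e]; exact hs
  · have e : (((2 * k + 1 : ℕ) : ℂ)) + 1 - s = 2 * (k : ℂ) + 2 - s := by push_cast; ring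
    rw [← e]; exact hFE s

/-- **The K7r input `H_FE` (Deuring currency): every odd power of a conj-equivariant character of type
`(1,0)` has a weight-`(2k+2)` functional equation with root number `±1`**, `∃ w ∈ {1,−1},
IsCentralRootNumberWt (φ^(2k+1)) k w` — `φ^{2k+1}` is equivariant of type `(2k+1, 0)`
(`IsHeckeConjEquivariant.pow`, `HasInfinityType.pow_oneZero`). This is the hypothesis `hw`/`hFE` of the
K7r reduction (`RubinPackageReduction.isCentralRootNumberWt_interpolated_one_of_xi`,
`oddPowerContinuation_of_FE`) for the characters produced by `Deuring_exists_heckeCharacter_of_maximalCM`.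
[cite: deShalit1987, II.1.1 (1)–(3)] [cite: SilvermanATAEC1994, Ch. II Thm. 9.2 and Thm. 10.5 (b) (the character ψ_{E/K}: type (1,0))] -/
theorem exists_isCentralRootNumberWt_pow (h : Hecke_functionalEquation_infinityType)
    (hK : IsImaginaryQuadratic K) {c : K ≃ₐ[ℚ] K} {φ : HeckeCharacter K}
    (hφ : φ.HasInfinityType (fun _ ↦ 1) (fun _ ↦ 0)) (heq : IsHeckeConjEquivariant c φ) (k : ℕ) :
    ∃ w : ℂ, (w = 1 ∨ w = -1) ∧ IsCentralRootNumberWt (φ ^ (2 * k + 1)) k w :=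
  exists_isCentralRootNumberWt_of_conjEquivariant h hK (hφ.pow_oneZero (2 * k + 1)) (heq.pow (2 * k + 1))

/-- **The same for the anticyclotomic twists `φ^{2k+1}ρ`** (`ρ` finite-order with `ρ∘c = ρ⁻¹`; then
`φ^{2k+1}ρ` is conj-equivariant of type `(2k+1,0)`): `∃ w ∈ {±1}, IsCentralRootNumberWt (φ^(2k+1)·ρ) k w`
— the shape of the sign binders `hsgn : IsCentralRootNumberWt (φ ^ (2k+1) * χ) k 1` of
`RubinPadicLFunctionData.thm412`/`thm72_one` ([BKNO] Thm. 1.5 / 1.8: "`ε(φχ) = +1`", resp. "`−1`"), up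
to WHICH sign occurs. [cite: BurungaleKobayashiNakamuraOta2026, Thm. 1.5 and Thm. 1.8 (arXiv:2608.06879 pp. 6–8) (the sign hypotheses; shape only)]
[cite: Jia2026ActaArith, §1 (χ = φρ is equivariant)] -/
theorem exists_isCentralRootNumberWt_pow_mul (h : Hecke_functionalEquation_infinityType)
    (hK : IsImaginaryQuadratic K) {c : K ≃ₐ[ℚ] K} {φ ρ : HeckeCharacter K}
    (hφ : φ.HasInfinityType (fun _ ↦ 1) (fun _ ↦ 0)) (heq : IsHeckeConjEquivariant c φ)
    (hρ : ρ.IsFiniteOrder) (hac : IsAnticyclotomicCharacter c ρ) (k : ℕ) :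
    ∃ w : ℂ, (w = 1 ∨ w = -1) ∧ IsCentralRootNumberWt (φ ^ (2 * k + 1) * ρ) k w := by
  refine exists_isCentralRootNumberWt_of_conjEquivariant h hK ?_
    ((heq.pow (2 * k + 1)).mul_of_isAnticyclotomic hρ hac)
  have h1 := (hφ.pow_oneZero (2 * k + 1)).mul' (hasInfinityType_zero_of_isFiniteOrder hρ)
  simp only [Pi.add_def, add_zero] at h1
  exact h1

/-- **The K7r input `S_hecke` (Deuring currency): entire continuation of `L(φ^{2k+1}, s)` from
`re s > k + 3/2`** for `φ` of infinity type `(1,0)` (the conclusion of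
`X12.O11.RamifiedCMOddPowerContinuationAtZp`; no equivariance needed). [cite: NeukirchANT1999, Ch. VII Cor. (8.6) (p. 503)]
[cite: Iwasawa2019, §3.5 Thm. 3.1] -/
theorem hasEntireContinuationFrom_pow_odd (h : Hecke_functionalEquation_infinityType)
    (hK : IsImaginaryQuadratic K) {φ : HeckeCharacter K}
    (hφ : φ.HasInfinityType (fun _ ↦ 1) (fun _ ↦ 0)) (k : ℕ) :
    LFunction.HasEntireContinuationFrom ((k : ℝ) + 3 / 2) (heckeLFunction (φ ^ (2 * k + 1))) := by
  have hc := h.hasEntireContinuationFrom hK (m := 2 * k + 1) (by omega) (hφ.pow_oneZero (2 * k + 1))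
  have e : (((2 * k + 1 : ℕ) : ℝ)) / 2 + 1 = (k : ℝ) + 3 / 2 := by push_cast; ring
  rwa [e] at hc

/-- **Granted Deuring's theorem AND Hecke's functional equation: the Grössencharacter of a maximal-order
CM curve over `ℚ` comes with all the functional equations the K7r package asks for.** For `E/ℚ`
(globally minimal model `W`) with CM by `𝒪_K`, `K = ` the CM field (`IsCMFieldOfJ K W.j`) with complex
conjugation `c ≠ 1`: there is `φ` with `L(φ, s) = L(E, s)` on `re s > 3/2`, of type `(1,0)`,
conj-equivariant, such that for every `k`, `L(φ^{2k+1}, s)` has a weight-`(2k+2)` functional equation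
with sign `±1` (`IsCentralRootNumberWt`) and an entire continuation from `re s > k + 3/2`.
[cite: SilvermanATAEC1994, Ch. II Thm. 9.2 and Thm. 10.5 (b)] [cite: deShalit1987, II.1.1 (1)–(3)] -/
theorem exists_pinned_functionalEquations_of_maximalCM (hD : Deuring_exists_heckeCharacter_of_maximalCM)
    (h : Hecke_functionalEquation_infinityType) (W : WeierstrassCurve ℚ) [W.IsElliptic]
    [W.IsGloballyMinimal] (hj : W.j ∈ maximalCMJInvariants) (hKj : IsCMFieldOfJ K W.j)
    (c : K ≃ₐ[ℚ] K) (hc : c ≠ 1) :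
    ∃ φ : HeckeCharacter K,
      (∀ s : ℂ, 3 / 2 < s.re → heckeLFunction φ s = W.LSeries s) ∧
      φ.HasInfinityType (fun _ ↦ 1) (fun _ ↦ 0) ∧ IsHeckeConjEquivariant c φ ∧
      (∀ k : ℕ, ∃ w : ℂ, (w = 1 ∨ w = -1) ∧ IsCentralRootNumberWt (φ ^ (2 * k + 1)) k w) ∧
      ∀ k : ℕ, LFunction.HasEntireContinuationFrom ((k : ℝ) + 3 / 2) (heckeLFunction (φ ^ (2 * k + 1))) := by
  obtain ⟨φ, hinf, heq, -, -, hL⟩ := hD W hj K hKj c hc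
  have hK : IsImaginaryQuadratic K := Deuring_exists_heckeCharacter_of_maximalCM.isImaginaryQuadratic hj hKj
  exact ⟨φ, hL, hinf, heq, fun k ↦ exists_isCentralRootNumberWt_pow h hK hinf heq k,
    fun k ↦ hasEntireContinuationFrom_pow_odd h hK hinf k⟩

/-! ### APPENDED 2026-08-27 (seat bsd-littype-10 gen 7, after W50 landed): the W50 DICTIONARY proved —
clauses (ii) + (vi) of `Deuring_exists_heckeCharacter_of_maximalCM_withGenerators` ⟹ the "Deuring-shaped
value pairs off a finite set" hypothesis `hφ` of K7r's Lemma Ξ files (`…LemmaXiDeuringGlue`,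
`…LemmaXiValuePairs`: `RubinPadicLFunctionData.galConj_η_eq_of_values` / `ξ_eq_φac_of_values`, (P1)/(P5)
of the Rubin package). Theorems only; 0 definitions, 0 facts. -/

/-- **Complex conjugation restricts to the non-trivial automorphism along every embedding of an
imaginary quadratic field**: `conj (σ x) = σ (c x)` for `σ : K → ℂ`, `c ≠ 1` (`σ`, `σ̄ = conj ∘ σ` and
`σ ∘ c` are three embeddings of which `[K : ℚ] = 2` exist; `σ̄ ≠ σ` since `K` is totally complex and
`σ ∘ c ≠ σ` since `c ≠ 1`). Silverman II Cor. 10.4.1 (b): "(The bar indicates complex conjugation of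
elements of `K`.)" — the identification used throughout II §§9–10. The statement of the tree's
`comp_eq_conjugate_of_ne_id` (`HeegnerPointReflectionProofs`, not imported here: Heegner-point closure)
for an `AlgEquiv`, re-proved in ten lines. [cite: Shimura1998, §8.4 Example (1)]
[cite: SilvermanATAEC1994, Ch. II Cor. 10.4.1 (b) (p. 171, "the bar indicates complex conjugation of elements of K")] -/
theorem starRingEnd_embedding_eq_embedding_algEquiv (hK : IsImaginaryQuadratic K) {c : K ≃ₐ[ℚ] K}
    (hc : c ≠ 1) (σ : K →+* ℂ) (x : K) : conj (σ x) = σ (c x) := by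
  classical
  haveI := hK.2
  set τ : K →+* ℂ := σ.comp (c : K →+* K) with hτ
  have hτx : ∀ y : K, τ y = σ (c y) := fun y ↦ rfl
  have h1 : ComplexEmbedding.conjugate σ ≠ σ := fun h ↦
    IsTotallyComplex.complexEmbedding_not_isReal σ (ComplexEmbedding.isReal_iff.mpr h)
  have h2 : τ ≠ σ := by
    intro h
    apply hc
    ext y
    rw [AlgEquiv.one_apply]
    exact σ.injective (by rw [← hτx y, h])
  by_contra hne
  have h3 : τ ≠ ComplexEmbedding.conjugate σ := by
    intro h
    exact hne (by rw [← hτx x, h, ComplexEmbedding.conjugate_coe_eq])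
  have hcard : Fintype.card (K →+* ℂ) = 2 := by rw [Embeddings.card, hK.1]
  have h3' : ({σ, ComplexEmbedding.conjugate σ, τ} : Finset (K →+* ℂ)).card = 3 := by
    rw [Finset.card_insert_of_notMem, Finset.card_pair h3.symm]
    simp only [Finset.mem_insert, Finset.mem_singleton, not_or]
    exact ⟨h1.symm, h2.symm⟩
  have := Finset.card_le_univ ({σ, ComplexEmbedding.conjugate σ, τ} : Finset (K →+* ℂ))
  omega

/-- **Values at conjugate places of a conj-equivariant character**: if `φ ∘ c = φ̄`
(`IsHeckeConjEquivariant c φ`) and `φ` is unramified at `c • w`, then `φ(ϖ_{c•w}) = conj (φ(ϖ_w))`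
(transport of the uniformiser, `valueAtUniformizer_galConj_of_isUnramifiedAt`, and equivariance,
`IsHeckeConjEquivariant.valueAtUniformizer_galConj'`). Silverman II Cor. 10.4.1 (b) / Jia §1
"`φ(𝔞̄) = \overline{φ(𝔞)}`" at a prime. [cite: Jia2026ActaArith, §1 (equivariant Hecke characters)]
[cite: SilvermanATAEC1994, Ch. II Cor. 10.4.1 (b) (p. 171)] -/
theorem _root_.Literature.NumberTheory.EllipticCurves.IsHeckeConjEquivariant.valueAtUniformizer_smul
    {c : K ≃ₐ[ℚ] K} {φ : HeckeCharacter K} (heq : IsHeckeConjEquivariant c φ)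
    {w : HeightOneSpectrum (𝓞 K)} (hw : φ.IsUnramifiedAt (c • w)) :
    φ.valueAtUniformizer (c • w) = conj (φ.valueAtUniformizer w) := by
  rw [← HeckeCharacter.valueAtUniformizer_galConj_of_isUnramifiedAt c φ w hw,
    heq.valueAtUniformizer_galConj']

/-- **Deuring-shaped value pairs off a finite set.** Let `K` be imaginary quadratic with non-trivial
automorphism `c`, `ψ` a conj-equivariant Hecke character (`ψ ∘ c = ψ̄`, clause (ii)) whose value at
every unramified `w` is `σ(α_w)` for a generator `α_w ∈ 𝒪_K` of `w` and one embedding `σ : K → ℂ`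
(clause (vi) of `Deuring_exists_heckeCharacter_of_maximalCM_withGenerators`: Silverman II Thm. 9.1 (i),
proof of Prop. 10.4, Cor. 10.4.1 (a)). Then for every finite place `𝔭`, off the finite set
`{ψ ramified} ∪ c⁻¹{ψ ramified} ∪ {𝔭}` (`finite_ramifiedPlaces_holds`): `ψ` is unramified at `w` and
`c • w`, and `ψ(ϖ_w) = σ(α)`, `ψ(ϖ_{c•w}) = σ(cα)` with `α ∉ 𝔭` (`α ∈ 𝔭` would force `w = (α) ≤ 𝔭`, so
`w = 𝔭`; and `ψ(ϖ_{c•w}) = conj ψ(ϖ_w) = conj σ(α) = σ(cα)`). This is LITERALLY the hypothesis `hφ` of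
`Summits/…/Theorems/RamifiedSevenEllipticUnitsLemmaXiDeuringGlue`'s
`RubinPadicLFunctionData.galConj_η_eq_of_values` / `ξ_eq_φac_of_values` (K7r Lemma Ξ, (P1)/(P5)).
PROVED; no fact consumed. [cite: SilvermanATAEC1994, Ch. II Thm. 9.1 (i) (p. 162), Cor. 10.4.1 (a)–(b) (p. 171)]
[cite: Jia2026ActaArith, §1 (equivariant Hecke characters)] -/
theorem _root_.Literature.NumberTheory.EllipticCurves.IsHeckeConjEquivariant.exists_valuePairs_of_generators
    (hK : IsImaginaryQuadratic K) {c : K ≃ₐ[ℚ] K} (hc : c ≠ 1) {ψ : HeckeCharacter K}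
    (heq : IsHeckeConjEquivariant c ψ) {σ : K →+* ℂ}
    (hgen : ∀ w : HeightOneSpectrum (𝓞 K), ψ.IsUnramifiedAt w →
      ∃ α : 𝓞 K, Ideal.span {α} = w.asIdeal ∧ ψ.valueAtUniformizer w = σ α)
    (𝔭 : HeightOneSpectrum (𝓞 K)) :
    ∃ S : Set (HeightOneSpectrum (𝓞 K)), S.Finite ∧ ∀ w ∉ S,
      ψ.IsUnramifiedAt w ∧ ψ.IsUnramifiedAt (c • w) ∧ ∃ α : 𝓞 K, α ∉ 𝔭.asIdeal ∧
        ψ.valueAtUniformizer w = σ (α : K) ∧ ψ.valueAtUniformizer (c • w) = σ (c (α : K)) := by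
  refine ⟨ψ.ramifiedPlaces ∪ (fun w ↦ c • w) ⁻¹' ψ.ramifiedPlaces ∪ {𝔭}, ?_, fun w hw ↦ ?_⟩
  · exact ((HeckeCharacter.finite_ramifiedPlaces_holds ψ).union
      ((HeckeCharacter.finite_ramifiedPlaces_holds ψ).preimage (MulAction.injective c).injOn)).union
      (Set.finite_singleton 𝔭)
  simp only [Set.mem_union, Set.mem_preimage, Set.mem_singleton_iff, not_or,
    HeckeCharacter.ramifiedPlaces, Set.mem_setOf_eq, not_not] at hw
  obtain ⟨⟨hunr, hunrc⟩, hw𝔭⟩ := hw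
  obtain ⟨α, hα, hval⟩ := hgen w hunr
  refine ⟨hunr, hunrc, α, fun hmem ↦ hw𝔭 ?_, hval, ?_⟩
  · -- `(α) = w ≤ 𝔭`, both maximal, so `w = 𝔭`
    have hle : w.asIdeal ≤ 𝔭.asIdeal := by
      rw [← hα, Ideal.span_singleton_le_iff_mem]
      exact hmem
    exact HeightOneSpectrum.ext (w.isMaximal.eq_of_le 𝔭.isPrime.ne_top hle)
  · -- `ψ(ϖ_{c•w}) = conj ψ(ϖ_w) = conj σ(α) = σ(cα)`
    rw [heq.valueAtUniformizer_smul hunrc, hval]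
    exact starRingEnd_embedding_eq_embedding_algEquiv hK hc σ α

/-- **Deuring's Grössencharacter comes with Deuring-shaped value pairs** (the W50 dictionary, end to
end): granted `Deuring_exists_heckeCharacter_of_maximalCM_withGenerators`, for a maximal-order CM curve
`E/ℚ` (globally minimal `W`, `W.j ∈ maximalCMJInvariants`), its CM field `K` (`IsCMFieldOfJ K W.j`) and
`c ≠ 1`, there is `ψ` with clauses (i)–(vi) AND (vii): one embedding `σ : K → ℂ` such that for every
finite place `𝔭`, off a finite set of `w`, `ψ` is unramified at `w`, `c • w` and `ψ(ϖ_w) = σ(α)`,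
`ψ(ϖ_{c•w}) = σ(cα)` for some `α ∈ 𝒪_K ∖ 𝔭` — the input of K7r's `galConj_η_eq_of_values` /
`ξ_eq_φac_of_values` for the SAME `ψ` that carries (iii)–(v). PROVED from the fact.
[cite: SilvermanATAEC1994, Ch. II Thm. 9.1 (i) (p. 162), Thm. 9.2 (p. 164–165), Cor. 10.4.1 (a)–(b) (p. 171), Thm. 10.5 (b)] -/
theorem _root_.Literature.NumberTheory.EllipticCurves.Deuring_exists_heckeCharacter_of_maximalCM_withGenerators.exists_with_valuePairs
    (hD : Deuring_exists_heckeCharacter_of_maximalCM_withGenerators) (W : WeierstrassCurve ℚ)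
    [W.IsElliptic] [W.IsGloballyMinimal] (hj : W.j ∈ maximalCMJInvariants) (hKj : IsCMFieldOfJ K W.j)
    (c : K ≃ₐ[ℚ] K) (hc : c ≠ 1) :
    ∃ ψ : HeckeCharacter K,
      ψ.HasInfinityType (fun _ ↦ 1) (fun _ ↦ 0) ∧
      IsHeckeConjEquivariant c ψ ∧
      (∀ w : HeightOneSpectrum (𝓞 K), ψ.IsUnramifiedAt w ↔ (W.baseChange K).HasGoodReductionAt w) ∧
      (∀ (p : ℕ) [Fact p.Prime], W.HasGoodReductionAtPrime p →
        ∀ w : HeightOneSpectrum (𝓞 K), (p : 𝓞 K) ∈ w.asIdeal →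
          ψ.IsUnramifiedAt w ∧
          (c • w ≠ w →
            ψ.valueAtUniformizer w + ψ.valueAtUniformizer (c • w) = (W.frobeniusTrace p : ℂ) ∧
            ψ.valueAtUniformizer w * ψ.valueAtUniformizer (c • w) = (p : ℂ)) ∧
          (c • w = w → W.frobeniusTrace p = 0 ∧ ψ.valueAtUniformizer w = -(p : ℂ))) ∧
      (∀ s : ℂ, 3 / 2 < s.re → heckeLFunction ψ s = W.LSeries s) ∧
      ∃ σ : K →+* ℂ,
        (∀ w : HeightOneSpectrum (𝓞 K), ψ.IsUnramifiedAt w →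
          ∃ α : 𝓞 K, Ideal.span {α} = w.asIdeal ∧ ψ.valueAtUniformizer w = σ α) ∧
        ∀ 𝔭 : HeightOneSpectrum (𝓞 K), ∃ S : Set (HeightOneSpectrum (𝓞 K)), S.Finite ∧ ∀ w ∉ S,
          ψ.IsUnramifiedAt w ∧ ψ.IsUnramifiedAt (c • w) ∧ ∃ α : 𝓞 K, α ∉ 𝔭.asIdeal ∧
            ψ.valueAtUniformizer w = σ (α : K) ∧ ψ.valueAtUniformizer (c • w) = σ (c (α : K)) := by
  obtain ⟨ψ, hinf, heq, hgood, hloc, hL, σ, hgen⟩ := hD W hj K hKj c hc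
  exact ⟨ψ, hinf, heq, hgood, hloc, hL, σ, hgen, fun 𝔭 ↦ heq.exists_valuePairs_of_generators
    (Deuring_exists_heckeCharacter_of_maximalCM.isImaginaryQuadratic hj hKj) hc hgen 𝔭⟩

end Literature.NumberTheory.EllipticCurves.BurungaleKobayashiNakamuraOta2026

end
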